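import Mathlib
import Literature.Geometry.Lorentzian.Basic
import Literature.Analysis.Calculus.PolarCoordinatesE3
import Summits.FinalStateConjecture.FinalStateConjecture.Theorems.StarvedNecksNecksCertifyStubHuygensNeckSphereMeans

/-!
# Line `cone-rates-are-iled`, stub S2c (`stub_retardedConeEstimate`): volume estimates

Helper file for the retarded-cone estimate of the Lie-dragged two-centre profile.  Everything
is Lebesgue-integral bookkeeping on `E3` (`σ = volume.toSphere`, the finite surface measure on the
unit sphere):

* `lintegral_closedBall_indicator_inv_norm_le` — `∫_{B̄(q,r)} dy/‖y‖ ≤ (σ(S²) + vol B̄(0,1)) r²`,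
  uniformly in the centre `q`;
* `lintegral_closedBall_indicator_drag_le` — for a map `Ψ` with `‖y₁ - y₂‖ ≤ 2‖Ψ y₁ - Ψ y₂‖` and
  `M + ‖Ψ‖ < 2^(K+1) M` on `B̄(0,T)`: `∫_{B̄(0,T)} dy/(‖y‖ (M + ‖Ψ y‖)²) ≤ 64 (K+1) (σ(S²) + vol B̄(0,1))`
  (dyadic shells in `M + ‖Ψ‖`, each inside a ball);
* `lintegral_Ioc_mul_sphere_eq` — polar coordinates about the observer,
  `∫_{0<s≤T} s ∫_{S²} G(s w) dσ ds = ∫_{B̄(0,T)} G(u)/‖u‖ du`;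
* `lintegral_closedBall_indicator_dragCentre_le` — the volume estimate for the dragged centre
  `Ψ y = x + y + a (t - ‖y‖) e`, `|a| ≤ 1/2`, `‖e‖ = 1`.

Mathlib plus the tree's polar-coordinate formulas; no definitions, no named facts.
-/

noncomputable section

open scoped Topology ENNReal BigOperators
open Filter Set MeasureTheory Metric Function Literature.Geometry.Lorentzian

-- the doubled `FinalStateConjecture.FinalStateConjecture` path component trips dupNamespace
set_option linter.dupNamespace false
set_option linter.style.longLine false

namespace Summit.FinalStateConjecture.FinalStateConjecture.Theorems.EIHFluxBalance.ConeRatesAreILED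

open Summit.FinalStateConjecture.FinalStateConjecture.Theorems.NecksCertifyTwoCap.Huygens

/-- **Ball lemma.** `∫_{B̄(q,r)} dy/‖y‖ ≤ (σ(S²) + vol B̄(0,1)) r²` for every centre `q` and radius
`r > 0`: the part inside `B(0,r)` is at most `σ(S²) r²` in polar coordinates, and on the rest the
integrand is at most `r⁻¹` while `vol B̄(q,r) = r³ vol B̄(0,1)`. -/
theorem lintegral_closedBall_indicator_inv_norm_le (q : E3) {r : ℝ} (hr : 0 < r) :
    ∫⁻ y, (closedBall q r).indicator (fun y ↦ (ENNReal.ofReal ‖y‖)⁻¹) y ≤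
      ENNReal.ofReal ((((volume : Measure E3).toSphere univ).toReal +
        (volume (closedBall (0 : E3) 1)).toReal) * r ^ 2) := by
  set μS : Measure (sphere (0 : E3) 1) := (volume : Measure E3).toSphere with hμS
  set F : ℝ → ℝ≥0∞ := fun ρ ↦ (Iio r).indicator (fun ρ ↦ (ENNReal.ofReal ρ)⁻¹) ρ with hF
  have hFm : Measurable F := (ENNReal.measurable_ofReal.inv).indicator measurableSet_Iio
  -- pointwise splitting into the part inside `B(0,r)` and the rest
  have h1 : ∀ y : E3, (closedBall q r).indicator (fun y ↦ (ENNReal.ofReal ‖y‖)⁻¹) y ≤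
      F ‖y‖ + (closedBall q r).indicator (fun _ ↦ (ENNReal.ofReal r)⁻¹) y := by
    intro y
    by_cases hy : y ∈ closedBall q r
    · rw [indicator_of_mem hy, indicator_of_mem hy]
      by_cases hyr : ‖y‖ < r
      · have hFy : F ‖y‖ = (ENNReal.ofReal ‖y‖)⁻¹ := by
          simp only [hF, indicator_of_mem (mem_Iio.2 hyr)]
        rw [hFy]
        exact le_self_add
      · exact le_add_left (ENNReal.inv_le_inv.2 (ENNReal.ofReal_le_ofReal (not_lt.1 hyr)))
    · rw [indicator_of_notMem hy]
      exact zero_le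
  -- the part inside `B(0,r)` in polar coordinates
  have h2 : ∫⁻ y : E3, F ‖y‖ ≤ μS univ * ENNReal.ofReal (r ^ 2) := by
    rw [Literature.Analysis.Calculus.lintegral_radial_eq F hFm]
    refine mul_le_mul_right ?_ _
    calc ∫⁻ ρ in Ioi (0 : ℝ), F ρ * ENNReal.ofReal (ρ ^ 2)
        ≤ ∫⁻ ρ in Ioi (0 : ℝ), (Iio r).indicator (fun _ ↦ ENNReal.ofReal r) ρ := by
          refine setLIntegral_mono' measurableSet_Ioi fun ρ hρ ↦ ?_
          by_cases hρr : ρ ∈ Iio r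
          · simp only [hF, indicator_of_mem hρr]
            rw [pow_two, ENNReal.ofReal_mul (le_of_lt hρ), ← mul_assoc,
              ENNReal.inv_mul_cancel ((ENNReal.ofReal_pos.2 hρ).ne') ENNReal.ofReal_ne_top,
              one_mul]
            exact ENNReal.ofReal_le_ofReal (le_of_lt hρr)
          · simp only [hF, indicator_of_notMem hρr, zero_mul, le_refl]
      _ = ENNReal.ofReal (r ^ 2) := by
          rw [lintegral_indicator_const measurableSet_Iio, Measure.restrict_apply measurableSet_Iio,
            Iio_inter_Ioi, Real.volume_Ioo, sub_zero, ← ENNReal.ofReal_mul hr.le, pow_two]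
  -- the rest: integrand at most `r⁻¹` on a ball of volume `r³ vol B̄(0,1)`
  have h3 : ∫⁻ y, (closedBall q r).indicator (fun _ ↦ (ENNReal.ofReal r)⁻¹) y =
      volume (closedBall (0 : E3) 1) * ENNReal.ofReal (r ^ 2) := by
    have hr3 : r⁻¹ * r ^ 3 = r ^ 2 := by field_simp
    rw [lintegral_indicator_const measurableSet_closedBall,
      Measure.addHaar_closedBall' volume q hr.le, finrank_euclideanSpace_fin, ← mul_assoc,
      ← ENNReal.ofReal_inv_of_pos hr, ← ENNReal.ofReal_mul (inv_nonneg.2 hr.le), hr3, mul_comm]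
  -- assemble
  calc ∫⁻ y, (closedBall q r).indicator (fun y ↦ (ENNReal.ofReal ‖y‖)⁻¹) y
      ≤ ∫⁻ y, (F ‖y‖ + (closedBall q r).indicator (fun _ ↦ (ENNReal.ofReal r)⁻¹) y) :=
        lintegral_mono h1
    _ = (∫⁻ y, F ‖y‖) + ∫⁻ y, (closedBall q r).indicator (fun _ ↦ (ENNReal.ofReal r)⁻¹) y :=
        lintegral_add_left (hFm.comp measurable_norm) _
    _ ≤ μS univ * ENNReal.ofReal (r ^ 2) +
          volume (closedBall (0 : E3) 1) * ENNReal.ofReal (r ^ 2) := by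
        rw [h3]
        exact add_le_add h2 le_rfl
    _ = ENNReal.ofReal (((μS univ).toReal + (volume (closedBall (0 : E3) 1)).toReal) * r ^ 2) := by
        rw [add_mul, ENNReal.ofReal_add (by positivity) (by positivity),
          ENNReal.ofReal_mul ENNReal.toReal_nonneg, ENNReal.ofReal_mul ENNReal.toReal_nonneg,
          ENNReal.ofReal_toReal (measure_ne_top _ _),
          ENNReal.ofReal_toReal measure_closedBall_lt_top.ne]

/-- A sublevel set `{‖Ψ‖ < ρ}` of a map with `‖y₁ - y₂‖ ≤ 2‖Ψ y₁ - Ψ y₂‖` lies in a ball of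
radius `4ρ` about any of its points, whence `∫_{‖Ψ‖ < ρ} dy/‖y‖ ≤ (σ(S²) + vol B̄(0,1)) (4ρ)²`. -/
theorem lintegral_sublevel_indicator_inv_norm_le {Ψ : E3 → E3}
    (hlip : ∀ y₁ y₂, ‖y₁ - y₂‖ ≤ 2 * ‖Ψ y₁ - Ψ y₂‖) {ρ : ℝ} (hρ : 0 < ρ) :
    ∫⁻ y, {y | ‖Ψ y‖ < ρ}.indicator (fun y ↦ (ENNReal.ofReal ‖y‖)⁻¹) y ≤
      ENNReal.ofReal ((((volume : Measure E3).toSphere univ).toReal +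
        (volume (closedBall (0 : E3) 1)).toReal) * (4 * ρ) ^ 2) := by
  by_cases hne : ∃ y₀, ‖Ψ y₀‖ < ρ
  · obtain ⟨y₀, hy₀⟩ := hne
    have hsub : {y | ‖Ψ y‖ < ρ} ⊆ closedBall y₀ (4 * ρ) := by
      intro y hy
      rw [mem_setOf_eq] at hy
      rw [mem_closedBall, dist_eq_norm]
      calc ‖y - y₀‖ ≤ 2 * ‖Ψ y - Ψ y₀‖ := hlip y y₀
        _ ≤ 2 * (‖Ψ y‖ + ‖Ψ y₀‖) := by gcongr; exact norm_sub_le _ _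
        _ ≤ 4 * ρ := by linarith
    calc ∫⁻ y, {y | ‖Ψ y‖ < ρ}.indicator (fun y ↦ (ENNReal.ofReal ‖y‖)⁻¹) y
        ≤ ∫⁻ y, (closedBall y₀ (4 * ρ)).indicator (fun y ↦ (ENNReal.ofReal ‖y‖)⁻¹) y :=
          lintegral_mono fun y ↦ indicator_le_indicator_of_subset hsub (fun _ ↦ zero_le) y
      _ ≤ _ := lintegral_closedBall_indicator_inv_norm_le y₀ (by positivity)
  · have h0 : ∀ y, {y | ‖Ψ y‖ < ρ}.indicator (fun y ↦ (ENNReal.ofReal ‖y‖)⁻¹) y = 0 := fun y ↦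
      indicator_of_notMem (show y ∉ {y | ‖Ψ y‖ < ρ} from fun hy ↦ hne ⟨y, hy⟩) _
    rw [lintegral_congr h0, lintegral_zero]
    exact zero_le

/-- Dyadic pigeonhole: a real number in `[1, 2^(K+1))` lies in some `[2^k, 2^(k+1))`, `k ≤ K`. -/
theorem exists_dyadic_shell {X : ℝ} (hX : 1 ≤ X) {K : ℕ} (hXK : X < 2 ^ (K + 1)) :
    ∃ k ∈ Finset.range (K + 1), (2 : ℝ) ^ k ≤ X ∧ X < 2 ^ (k + 1) := by
  obtain ⟨k, hk1, hk2⟩ := exists_nat_pow_near hX one_lt_two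
  exact ⟨k, Finset.mem_range.2 ((pow_lt_pow_iff_right₀ one_lt_two).1 (hk1.trans_lt hXK)),
    hk1, hk2⟩

/-- **The volume estimate.** If `‖y₁ - y₂‖ ≤ 2‖Ψ y₁ - Ψ y₂‖` and `M + ‖Ψ‖ < 2^(K+1) M` on
`B̄(0,T)`, then `∫_{B̄(0,T)} dy / (‖y‖ (M + ‖Ψ y‖)²) ≤ 64 (K + 1) (σ(S²) + vol B̄(0,1))`: on the
dyadic shell `2^k M ≤ M + ‖Ψ‖ < 2^(k+1) M` (`k ≤ K`) the weight is at most `(2^k M)⁻²`, and the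
shell lies in `{‖Ψ‖ < 2^(k+1) M}`, a set of `∫ dy/‖y‖`-mass at most `(σ(S²) + vol B̄(0,1)) (2^(k+3) M)²`. -/
theorem lintegral_closedBall_indicator_drag_le {Ψ : E3 → E3} (hΨ : Measurable Ψ)
    (hlip : ∀ y₁ y₂, ‖y₁ - y₂‖ ≤ 2 * ‖Ψ y₁ - Ψ y₂‖) {M : ℝ} (hM : 0 < M) (T : ℝ) {K : ℕ}
    (hK : ∀ y ∈ closedBall (0 : E3) T, M + ‖Ψ y‖ < 2 ^ (K + 1) * M) :
    ∫⁻ y, (closedBall (0 : E3) T).indicator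
        (fun y ↦ ENNReal.ofReal ((M + ‖Ψ y‖)⁻¹ ^ 2) * (ENNReal.ofReal ‖y‖)⁻¹) y ≤
      ENNReal.ofReal ((K + 1) * (64 * ((((volume : Measure E3).toSphere univ).toReal +
        (volume (closedBall (0 : E3) 1)).toReal)))) := by
  set C : ℝ := ((volume : Measure E3).toSphere univ).toReal +
    (volume (closedBall (0 : E3) 1)).toReal with hC
  have hC0 : 0 ≤ C := by positivity
  have hgm : Measurable fun y ↦ M + ‖Ψ y‖ := measurable_const.add hΨ.norm
  -- the dyadic shells and their weights
  set S : ℕ → Set E3 := fun k ↦ (fun y ↦ M + ‖Ψ y‖) ⁻¹' Ico (2 ^ k * M) (2 ^ (k + 1) * M) with hS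
  set H : ℕ → E3 → ℝ≥0∞ := fun k y ↦
    ENNReal.ofReal ((2 ^ k * M)⁻¹ ^ 2) * (ENNReal.ofReal ‖y‖)⁻¹ with hH
  have hSm : ∀ k, MeasurableSet (S k) := fun k ↦ hgm measurableSet_Ico
  have hHm : ∀ k, Measurable (H k) := fun k ↦
    measurable_const.mul (ENNReal.measurable_ofReal.comp measurable_norm).inv
  -- pointwise domination by the sum over the shells
  have hpt : ∀ y, (closedBall (0 : E3) T).indicator
      (fun y ↦ ENNReal.ofReal ((M + ‖Ψ y‖)⁻¹ ^ 2) * (ENNReal.ofReal ‖y‖)⁻¹) y ≤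
      ∑ k ∈ Finset.range (K + 1), (S k).indicator (H k) y := by
    intro y
    by_cases hy : y ∈ closedBall (0 : E3) T
    · rw [indicator_of_mem hy]
      have hX : 1 ≤ (M + ‖Ψ y‖) / M := by
        rw [le_div_iff₀ hM, one_mul]
        linarith [norm_nonneg (Ψ y)]
      have hXK : (M + ‖Ψ y‖) / M < 2 ^ (K + 1) := by
        rw [div_lt_iff₀ hM]
        exact hK y hy
      obtain ⟨k, hk, hk1, hk2⟩ := exists_dyadic_shell hX hXK
      rw [le_div_iff₀ hM] at hk1
      rw [div_lt_iff₀ hM] at hk2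
      have hyS : y ∈ S k := by
        simp only [hS, mem_preimage, mem_Ico]
        exact ⟨hk1, hk2⟩
      have hle : (M + ‖Ψ y‖)⁻¹ ^ 2 ≤ (2 ^ k * M)⁻¹ ^ 2 :=
        pow_le_pow_left₀ (inv_nonneg.2 (by positivity)) (inv_anti₀ (by positivity) hk1) 2
      calc ENNReal.ofReal ((M + ‖Ψ y‖)⁻¹ ^ 2) * (ENNReal.ofReal ‖y‖)⁻¹ ≤ H k y :=
            mul_le_mul_left (ENNReal.ofReal_le_ofReal hle) _
        _ = (S k).indicator (H k) y := (indicator_of_mem hyS _).symm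
        _ ≤ ∑ k ∈ Finset.range (K + 1), (S k).indicator (H k) y :=
            Finset.single_le_sum (f := fun k ↦ (S k).indicator (H k) y)
              (fun _ _ ↦ zero_le) hk
    · rw [indicator_of_notMem hy]
      exact zero_le
  -- each shell contributes at most `64 C`
  have hshell : ∀ k ∈ Finset.range (K + 1),
      ∫⁻ y, (S k).indicator (H k) y ≤ ENNReal.ofReal (64 * C) := by
    intro k _
    have hsub : ∀ y, (S k).indicator (H k) y ≤ ENNReal.ofReal ((2 ^ k * M)⁻¹ ^ 2) *
        {y | ‖Ψ y‖ < 2 ^ (k + 1) * M}.indicator (fun y ↦ (ENNReal.ofReal ‖y‖)⁻¹) y := by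
      intro y
      by_cases hy : y ∈ S k
      · have hy2 : M + ‖Ψ y‖ < 2 ^ (k + 1) * M := by
          simp only [hS, mem_preimage, mem_Ico] at hy
          exact hy.2
        have hy' : y ∈ {y | ‖Ψ y‖ < 2 ^ (k + 1) * M} := by
          rw [mem_setOf_eq]
          linarith
        simp only [hH, indicator_of_mem hy, indicator_of_mem hy', le_refl]
      · rw [indicator_of_notMem hy]
        exact zero_le
    calc ∫⁻ y, (S k).indicator (H k) y
        ≤ ∫⁻ y, ENNReal.ofReal ((2 ^ k * M)⁻¹ ^ 2) *
            {y | ‖Ψ y‖ < 2 ^ (k + 1) * M}.indicator (fun y ↦ (ENNReal.ofReal ‖y‖)⁻¹) y :=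
          lintegral_mono hsub
      _ = ENNReal.ofReal ((2 ^ k * M)⁻¹ ^ 2) *
            ∫⁻ y, {y | ‖Ψ y‖ < 2 ^ (k + 1) * M}.indicator (fun y ↦ (ENNReal.ofReal ‖y‖)⁻¹) y :=
          lintegral_const_mul' _ _ ENNReal.ofReal_ne_top
      _ ≤ ENNReal.ofReal ((2 ^ k * M)⁻¹ ^ 2) * ENNReal.ofReal (C * (4 * (2 ^ (k + 1) * M)) ^ 2) :=
          mul_le_mul_right (lintegral_sublevel_indicator_inv_norm_le hlip (by positivity)) _
      _ = ENNReal.ofReal (64 * C) := by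
          rw [← ENNReal.ofReal_mul (by positivity)]
          congr 1
          have hM' : M ≠ 0 := hM.ne'
          field_simp
          ring
  -- sum over the shells
  calc ∫⁻ y, (closedBall (0 : E3) T).indicator
        (fun y ↦ ENNReal.ofReal ((M + ‖Ψ y‖)⁻¹ ^ 2) * (ENNReal.ofReal ‖y‖)⁻¹) y
      ≤ ∫⁻ y, ∑ k ∈ Finset.range (K + 1), (S k).indicator (H k) y := lintegral_mono hpt
    _ = ∑ k ∈ Finset.range (K + 1), ∫⁻ y, (S k).indicator (H k) y :=
        lintegral_finsetSum _ fun k _ ↦ (hHm k).indicator (hSm k)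
    _ ≤ ∑ k ∈ Finset.range (K + 1), ENNReal.ofReal (64 * C) := Finset.sum_le_sum hshell
    _ = ENNReal.ofReal ((K + 1) * (64 * C)) := by
        rw [Finset.sum_const, Finset.card_range, nsmul_eq_mul,
          show ((K : ℝ) + 1) = ((K + 1 : ℕ) : ℝ) by push_cast; ring,
          ENNReal.ofReal_mul (Nat.cast_nonneg _), ENNReal.ofReal_natCast]

/-- **Polar coordinates about the observer**:
`∫_{0<s≤T} s (∫_{S²} G(s w) dσ(w)) ds = ∫_{B̄(0,T)} G(u)/‖u‖ du` for measurable `G ≥ 0`. -/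
theorem lintegral_Ioc_mul_sphere_eq {G : E3 → ℝ≥0∞} (hG : Measurable G) (T : ℝ) :
    ∫⁻ s in Ioc (0 : ℝ) T, ENNReal.ofReal s * ∫⁻ w, G (s • (w : E3))
        ∂(volume : Measure E3).toSphere =
      ∫⁻ u, (closedBall (0 : E3) T).indicator (fun u ↦ G u * (ENNReal.ofReal ‖u‖)⁻¹) u := by
  set μS : Measure (sphere (0 : E3) 1) := (volume : Measure E3).toSphere with hμS
  set Φ : E3 → ℝ≥0∞ := fun u ↦ (closedBall (0 : E3) T).indicator
    (fun u ↦ G u * (ENNReal.ofReal ‖u‖)⁻¹) u with hΦ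
  have hΦm : Measurable Φ :=
    (hG.mul (ENNReal.measurable_ofReal.comp measurable_norm).inv).indicator
      measurableSet_closedBall
  change _ = ∫⁻ u, Φ u
  rw [SphereMeans.lintegral_eq_lintegral_Ioi_sq_mul hΦm]
  have h5 : ∀ r ∈ Ioi (0 : ℝ), ENNReal.ofReal (r ^ 2) * (∫⁻ w, Φ (r • (w : E3)) ∂μS) =
      (Iic T).indicator (fun r ↦ ENNReal.ofReal r * ∫⁻ w, G (r • (w : E3)) ∂μS) r := by
    intro r hr
    have hn : ∀ w : sphere (0 : E3) 1, ‖r • (w : E3)‖ = r := fun w ↦ by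
      rw [norm_smul, Real.norm_eq_abs, abs_of_pos hr, norm_eq_of_mem_sphere w, mul_one]
    by_cases hrT : r ∈ Iic T
    · rw [indicator_of_mem hrT]
      have hmem : ∀ w : sphere (0 : E3) 1, r • (w : E3) ∈ closedBall (0 : E3) T := fun w ↦ by
        rw [mem_closedBall_zero_iff, hn w]
        exact hrT
      have hinv : ENNReal.ofReal (r ^ 2) * (ENNReal.ofReal r)⁻¹ = ENNReal.ofReal r := by
        rw [pow_two, ENNReal.ofReal_mul (le_of_lt hr), mul_assoc,
          ENNReal.mul_inv_cancel ((ENNReal.ofReal_pos.2 hr).ne') ENNReal.ofReal_ne_top, mul_one]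
      rw [← lintegral_const_mul' _ _ ENNReal.ofReal_ne_top,
        ← lintegral_const_mul' _ _ ENNReal.ofReal_ne_top]
      refine lintegral_congr fun w ↦ ?_
      simp only [hΦ, indicator_of_mem (hmem w), hn w]
      rw [mul_left_comm, hinv, mul_comm]
    · rw [indicator_of_notMem hrT]
      have h0 : ∀ w : sphere (0 : E3) 1, Φ (r • (w : E3)) = 0 := fun w ↦ by
        have hnm : r • (w : E3) ∉ closedBall (0 : E3) T := by
          rw [mem_closedBall_zero_iff, hn w]
          exact hrT
        simp only [hΦ, indicator_of_notMem hnm]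
      simp [h0]
  rw [setLIntegral_congr_fun measurableSet_Ioi h5, lintegral_indicator measurableSet_Iic,
    Measure.restrict_restrict measurableSet_Iic, Iic_inter_Ioi]

/-- The dragged-centre map `y ↦ x + y + (a (t - ‖y‖)) • e` (`‖e‖ = 1`, `|a| ≤ 1/2`) satisfies
`‖y₁ - y₂‖ ≤ 2 ‖Ψ y₁ - Ψ y₂‖`. -/
theorem norm_sub_le_two_mul_norm_dragCentre_sub (x e : E3) (he : ‖e‖ = 1) {a : ℝ}
    (ha : |a| ≤ 1 / 2) (t : ℝ) (y₁ y₂ : E3) :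
    ‖y₁ - y₂‖ ≤ 2 * ‖(x + y₁ + (a * (t - ‖y₁‖)) • e) - (x + y₂ + (a * (t - ‖y₂‖)) • e)‖ := by
  have h1 : (x + y₁ + (a * (t - ‖y₁‖)) • e) - (x + y₂ + (a * (t - ‖y₂‖)) • e) =
      (y₁ - y₂) - (a * (‖y₁‖ - ‖y₂‖)) • e := by
    rw [show a * (‖y₁‖ - ‖y₂‖) = a * (t - ‖y₂‖) - a * (t - ‖y₁‖) by ring, sub_smul]
    abel
  have h2 : ‖(a * (‖y₁‖ - ‖y₂‖)) • e‖ ≤ 1 / 2 * ‖y₁ - y₂‖ := by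
    rw [norm_smul, he, mul_one, Real.norm_eq_abs, abs_mul]
    exact mul_le_mul ha (abs_norm_sub_norm_le y₁ y₂) (abs_nonneg _) (by norm_num)
  rw [h1]
  linarith [norm_sub_norm_le (y₁ - y₂) ((a * (‖y₁‖ - ‖y₂‖)) • e)]

/-- **The volume estimate for a dragged centre**: for `‖x‖ ≤ t`, `0 ≤ T ≤ t`, `|a| ≤ 1/2`,
`‖e‖ = 1` and `M + 3t < 2^(K+1) M`,
`∫_{B̄(0,T)} dy / (‖y‖ (M + ‖x + y + a(t - ‖y‖) e‖)²) ≤ 64 (K+1) (σ(S²) + vol B̄(0,1))`. -/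
theorem lintegral_closedBall_indicator_dragCentre_le (x e : E3) (he : ‖e‖ = 1) {a : ℝ}
    (ha : |a| ≤ 1 / 2) {M t T : ℝ} (hM : 0 < M) (hT : 0 ≤ T) (hTt : T ≤ t) (hx : ‖x‖ ≤ t)
    {K : ℕ} (hK : M + 3 * t < 2 ^ (K + 1) * M) :
    ∫⁻ y, (closedBall (0 : E3) T).indicator (fun y ↦
        ENNReal.ofReal ((M + ‖x + y + (a * (t - ‖y‖)) • e‖)⁻¹ ^ 2) * (ENNReal.ofReal ‖y‖)⁻¹) y ≤
      ENNReal.ofReal ((K + 1) * (64 * ((((volume : Measure E3).toSphere univ).toReal +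
        (volume (closedBall (0 : E3) 1)).toReal)))) := by
  have hc : Continuous fun y : E3 ↦ x + y + (a * (t - ‖y‖)) • e := by fun_prop
  refine lintegral_closedBall_indicator_drag_le (Ψ := fun y ↦ x + y + (a * (t - ‖y‖)) • e)
    hc.measurable (norm_sub_le_two_mul_norm_dragCentre_sub x e he ha t) hM T fun y hy ↦ ?_
  rw [mem_closedBall_zero_iff] at hy
  have h1 : ‖x + y + (a * (t - ‖y‖)) • e‖ ≤ ‖x‖ + ‖y‖ + |a| * |t - ‖y‖| := by
    refine (norm_add_le _ _).trans (add_le_add (norm_add_le _ _) (le_of_eq ?_))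
    rw [norm_smul, he, mul_one, Real.norm_eq_abs, abs_mul]
  have h2 : |t - ‖y‖| ≤ t := by
    rw [abs_of_nonneg (by linarith [norm_nonneg y])]
    linarith [norm_nonneg y]
  have h3 : |a| * |t - ‖y‖| ≤ 1 / 2 * t := mul_le_mul ha h2 (abs_nonneg _) (by norm_num)
  show M + ‖x + y + (a * (t - ‖y‖)) • e‖ < 2 ^ (K + 1) * M
  linarith

/-- Registered sub-goal of `stub_retardedConeEstimate` (the volume estimate for a dragged centre):
statement of `lintegral_closedBall_indicator_dragCentre_le`. -/
theorem stub_retardedConeEstimate_dragCentreVolume : ∀ (x e : E3) (a M t T : ℝ) (K : ℕ), ‖e‖ = 1 → |a| ≤ 1 / 2 → 0 < M → 0 ≤ T → T ≤ t → ‖x‖ ≤ t → M + 3 * t < 2 ^ (K + 1) * M → ∫⁻ y, (closedBall (0 : E3) T).indicator (fun y ↦ ENNReal.ofReal ((M + ‖x + y + (a * (t - ‖y‖)) • e‖)⁻¹ ^ 2) * (ENNReal.ofReal ‖y‖)⁻¹) y ≤ ENNReal.ofReal ((K + 1) * (64 * ((((volume : Measure E3).toSphere univ).toReal + (volume (closedBall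 (0 : E3) 1)).toReal)))) :=
  fun x e _ _ _ _ _ he ha hM hT hTt hx hK ↦
    lintegral_closedBall_indicator_dragCentre_le x e he ha hM hT hTt hx hK

end Summit.FinalStateConjecture.FinalStateConjecture.Theorems.EIHFluxBalance.ConeRatesAreILED

end
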